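import Mathlib
import Summits.PneNP.PneNP.Theorems.OverlapGapAlgebraSolvableImpliesStableSectionTwoWayRepairWeightStepOdd
import Summits.PneNP.PneNP.Theorems.OverlapGapAlgebraSolvableImpliesStableSectionTwoWayRepairWeightNum

/-!
# PneNP / OverlapGapAlgebra — crux `SolvableImpliesStableSection` (stmt-PneNP-2463):
# the TWO-WAY REPAIR block (4b/·) — tree codes: geometric decay of the weights, no dead floor

Support for crux `stmt-PneNP-2463` (`Summit.PneNP.PneNP.Theses.OverlapGapAlgebra.SolvableImpliesStableSection`):
the f-free block "bounded-round two-way repair with one-round memory gives stable sections for every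
`ν > 0` up to `α ≤ 2^k/(4k)`".  Write `A_d(s)` for the total weight of the locally valid codes of
`TS d` with a childless root slot (unique if the root code is odd) and root ROUND `s` (codes `2s`,
`2s+1`) — up to the factor `#Inst`, the expected number of injective witness trees of the clauses
flipping a variable at round `s`.  Every such root is recent (the two-way rule has no dead clauses), so
from `…TwoWayRepairWeightStep(Odd)`, `A_{d+1}(s) ≤ m·k·2^{-k}·(A_d(s-1)/n)·[(1+U/n)^{k-1} + k(U/n)^{k-2}]`
with `U ≤ ∑_{s'<s} A_d(s')`, whence:

* (`sissW_exp34`, `sissW_num_bracket`, `sissW_num_core` — the scalar inequalities: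
  `…TwoWayRepairWeightNum`);
* `sissW_weight_decay` — under `4k·m ≤ 2^k·n` (density `≤ 2^k/(4k)`) and `k ≥ 3`:
  `A_d(s) ≤ m·2^{-k}·(2/3)^s` for all `d, s` — the cascade dies out geometrically and NOTHING is left
  behind (contrast `sissR_weight_root`: dead term `(2m/(2^k n))^k`).
No definitions (all objects are hypotheses); axioms `propext`, `Classical.choice`, `Quot.sound`.
-/

set_option linter.dupNamespace false -- `Summit.PneNP.PneNP.…`: summit = sub-problem (D-0017)

namespace Summit.PneNP.PneNP.Theorems

open Finset
open scoped Classical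

section WeightBound

variable {m k n : ℕ}
/-- **Geometric decay of the weights, no floor.** Under `4k·m ≤ 2^k·n` and `k ≥ 3`, for every depth
`d` and round `s`, the locally valid codes of `TS d` with a childless root slot (unique if the root
code is odd) and root round `s` have total weight at most `m·2^{-k}·(2/3)^s`. -/
theorem sissW_weight_decay (asm : Fin m → ℕ → (Fin k → Option (Finset (List (Fin k) × (Fin m × ℕ)))) → Finset (List (Fin k) × (Fin m × ℕ)))
    (hasm : ∀ (c : Fin m) (r : ℕ) (ch : Fin k → Option (Finset (List (Fin k) × (Fin m × ℕ))))
      (e : (List (Fin k) × (Fin m × ℕ))), e ∈ asm c r ch ↔ (e = ([], (c, r)) ∨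
      ∃ (j : Fin k) (S : Finset (List (Fin k) × (Fin m × ℕ))), ch j = some S ∧
        ∃ b : List (Fin k), (b, e.2) ∈ S ∧ e.1 = b ++ [j]))
    (TS : ℕ → Finset (Finset (List (Fin k) × (Fin m × ℕ)))) (L : ℕ)
    (hTS0 : ∀ T : Finset (List (Fin k) × (Fin m × ℕ)), T ∈ TS 0 ↔
      ∃ (c : Fin m) (r : ℕ), r ≤ L ∧ T = asm c r (fun _ => none))
    (hTSs : ∀ (d : ℕ) (T : Finset (List (Fin k) × (Fin m × ℕ))), T ∈ TS (d + 1) ↔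
      ∃ (c : Fin m) (r : ℕ), r ≤ L ∧ ∃ ch : Fin k → Option (Finset (List (Fin k) × (Fin m × ℕ))),
        (∀ (j : Fin k) (S : Finset (List (Fin k) × (Fin m × ℕ))), ch j = some S → S ∈ TS d) ∧ T = asm c r ch)
    (hk : 3 ≤ k) (hn : 1 ≤ n) (hα : (m : ℝ) * (4 * k) ≤ (n : ℝ) * 2 ^ k) :
    ∀ (d s : ℕ), ∑ S ∈ (TS d).filter (fun S => (((∀ e ∈ S, ∀ (j : Fin k) (y : Fin m) (s : ℕ), (j :: e.1, (y, s)) ∈ S →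
        s / 2 < e.2.2 / 2 ∧ ∃ j' : Fin k, ∀ lab : Fin m × ℕ, (j' :: j :: e.1, lab) ∉ S) ∧
      (∀ e ∈ S, ∀ (j : Fin k) (y : Fin m) (s : ℕ), (j :: e.1, (y, s)) ∈ S → s % 2 = 1 →
        ∀ j₁ j₂ : Fin k, (∀ lab : Fin m × ℕ, (j₁ :: j :: e.1, lab) ∉ S) →
          (∀ lab : Fin m × ℕ, (j₂ :: j :: e.1, lab) ∉ S) → j₁ = j₂) ∧
      (∀ e ∈ S, 1 ≤ e.2.2 / 2 → ∃ (j : Fin k) (y : Fin m) (s : ℕ),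
        (j :: e.1, (y, s)) ∈ S ∧ s / 2 + 1 = e.2.2 / 2))) ∧ (∃ j : Fin k, ∀ lab : Fin m × ℕ, ([j], lab) ∉ S) ∧ ((∀ (y : Fin m) (s : ℕ), (([] : List (Fin k)), (y, s)) ∈ S → s % 2 = 1 →
        ∀ j₁ j₂ : Fin k, (∀ lab : Fin m × ℕ, ([j₁], lab) ∉ S) →
          (∀ lab : Fin m × ℕ, ([j₂], lab) ∉ S) → j₁ = j₂)) ∧
        ∃ (y : Fin m) (r : ℕ), (([] : List (Fin k)), (y, r)) ∈ S ∧ r / 2 = s), (∏ e ∈ S, ((1 / 2 : ℝ) ^ k * (if e.1 = [] then (1 : ℝ) else 1 / (n : ℝ))))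
      ≤ (m : ℝ) * (1 / 2 : ℝ) ^ k * (2 / 3 : ℝ) ^ s := by
  have hk0 : (0 : ℝ) < k := by exact_mod_cast (show 0 < k by omega)
  have hn0 : (0 : ℝ) < n := by exact_mod_cast hn
  have hm0 : (0 : ℝ) ≤ m := Nat.cast_nonneg _
  -- the key density consequence: `D = m 2^{-k} / n ≤ 1/(4k)`
  have hdens : (m : ℝ) * (1 / 2 : ℝ) ^ k / n ≤ 1 / (4 * k) := by
    rw [div_le_div_iff₀ hn0 (by positivity), one_div_pow, ← div_eq_mul_one_div, div_mul_eq_mul_div,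
      div_le_iff₀ (by positivity)]
    linarith
  have hkD : (k : ℝ) * ((m : ℝ) * (1 / 2 : ℝ) ^ k / n) ≤ 1 / 4 := by
    calc (k : ℝ) * ((m : ℝ) * (1 / 2 : ℝ) ^ k / n) ≤ k * (1 / (4 * k)) :=
          mul_le_mul_of_nonneg_left hdens hk0.le
      _ = 1 / 4 := by field_simp
  -- round `0` at any positive depth
  have hzero : ∀ d : ℕ, ∑ S ∈ (TS (d + 1)).filter (fun S => (((∀ e ∈ S, ∀ (j : Fin k) (y : Fin m) (s : ℕ), (j :: e.1, (y, s)) ∈ S →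
        s / 2 < e.2.2 / 2 ∧ ∃ j' : Fin k, ∀ lab : Fin m × ℕ, (j' :: j :: e.1, lab) ∉ S) ∧
      (∀ e ∈ S, ∀ (j : Fin k) (y : Fin m) (s : ℕ), (j :: e.1, (y, s)) ∈ S → s % 2 = 1 →
        ∀ j₁ j₂ : Fin k, (∀ lab : Fin m × ℕ, (j₁ :: j :: e.1, lab) ∉ S) →
          (∀ lab : Fin m × ℕ, (j₂ :: j :: e.1, lab) ∉ S) → j₁ = j₂) ∧
      (∀ e ∈ S, 1 ≤ e.2.2 / 2 → ∃ (j : Fin k) (y : Fin m) (s : ℕ),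
        (j :: e.1, (y, s)) ∈ S ∧ s / 2 + 1 = e.2.2 / 2))) ∧ (∃ j : Fin k, ∀ lab : Fin m × ℕ, ([j], lab) ∉ S) ∧ ((∀ (y : Fin m) (s : ℕ), (([] : List (Fin k)), (y, s)) ∈ S → s % 2 = 1 →
        ∀ j₁ j₂ : Fin k, (∀ lab : Fin m × ℕ, ([j₁], lab) ∉ S) →
          (∀ lab : Fin m × ℕ, ([j₂], lab) ∉ S) → j₁ = j₂)) ∧
      ∃ (y : Fin m) (r : ℕ), (([] : List (Fin k)), (y, r)) ∈ S ∧ r / 2 = 0), (∏ e ∈ S, ((1 / 2 : ℝ) ^ k * (if e.1 = [] then (1 : ℝ) else 1 / (n : ℝ))))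
        ≤ (m : ℝ) * (1 / 2 : ℝ) ^ k := by
    intro d
    refine le_trans (Finset.sum_le_sum_of_subset_of_nonneg ?_ fun S _ _ => sissR_wt_nonneg S)
      (sissW_weight_zero asm hasm TS L hTS0 hTSs (by omega) d)
    intro S hS
    rw [Finset.mem_filter] at hS ⊢
    exact ⟨hS.1, hS.2.1, hS.2.2.2.1, hS.2.2.2.2⟩
  intro d
  induction d with
  | zero =>
    intro s
    rcases Nat.eq_zero_or_pos s with hs0 | hs
    · rw [hs0, pow_zero, mul_one]
      refine le_trans (Finset.sum_le_sum_of_subset_of_nonneg ?_ fun S _ _ => sissR_wt_nonneg S) (hzero 0)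
      intro S hS
      rw [Finset.mem_filter] at hS ⊢
      exact ⟨sissR_TS_mono asm TS L hTS0 hTSs 0 S hS.1, hS.2⟩
    · have hempty := sissW_weight_base_empty asm hasm TS L hTS0 s hs
      have hsub : (TS 0).filter (fun S => (((∀ e ∈ S, ∀ (j : Fin k) (y : Fin m) (s : ℕ), (j :: e.1, (y, s)) ∈ S →
        s / 2 < e.2.2 / 2 ∧ ∃ j' : Fin k, ∀ lab : Fin m × ℕ, (j' :: j :: e.1, lab) ∉ S) ∧
      (∀ e ∈ S, ∀ (j : Fin k) (y : Fin m) (s : ℕ), (j :: e.1, (y, s)) ∈ S → s % 2 = 1 →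
        ∀ j₁ j₂ : Fin k, (∀ lab : Fin m × ℕ, (j₁ :: j :: e.1, lab) ∉ S) →
          (∀ lab : Fin m × ℕ, (j₂ :: j :: e.1, lab) ∉ S) → j₁ = j₂) ∧
      (∀ e ∈ S, 1 ≤ e.2.2 / 2 → ∃ (j : Fin k) (y : Fin m) (s : ℕ),
        (j :: e.1, (y, s)) ∈ S ∧ s / 2 + 1 = e.2.2 / 2))) ∧ (∃ j : Fin k, ∀ lab : Fin m × ℕ, ([j], lab) ∉ S) ∧ ((∀ (y : Fin m) (s : ℕ), (([] : List (Fin k)), (y, s)) ∈ S → s % 2 = 1 →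
        ∀ j₁ j₂ : Fin k, (∀ lab : Fin m × ℕ, ([j₁], lab) ∉ S) →
          (∀ lab : Fin m × ℕ, ([j₂], lab) ∉ S) → j₁ = j₂)) ∧
          ∃ (y : Fin m) (r : ℕ), (([] : List (Fin k)), (y, r)) ∈ S ∧ r / 2 = s) = ∅ := by
        rw [← Finset.subset_empty, ← hempty]
        intro S hS
        rw [Finset.mem_filter] at hS ⊢
        exact ⟨hS.1, hS.2.1, hS.2.2.2.2⟩
      rw [hsub, Finset.sum_empty]
      positivity
  | succ d ih =>
    intro s
    rcases Nat.eq_zero_or_pos s with hs0 | hs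
    · rw [hs0, pow_zero, mul_one]; exact hzero d
    -- the two root parities: even roots are recent, odd roots are recent with a unique childless slot
    set Ceven : Finset (Finset (List (Fin k) × (Fin m × ℕ))) := (TS (d + 1)).filter (fun T => (((∀ e ∈ T, ∀ (j : Fin k) (y : Fin m) (s : ℕ), (j :: e.1, (y, s)) ∈ T →
        s / 2 < e.2.2 / 2 ∧ ∃ j' : Fin k, ∀ lab : Fin m × ℕ, (j' :: j :: e.1, lab) ∉ T) ∧
      (∀ e ∈ T, ∀ (j : Fin k) (y : Fin m) (s : ℕ), (j :: e.1, (y, s)) ∈ T → s % 2 = 1 →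
        ∀ j₁ j₂ : Fin k, (∀ lab : Fin m × ℕ, (j₁ :: j :: e.1, lab) ∉ T) →
          (∀ lab : Fin m × ℕ, (j₂ :: j :: e.1, lab) ∉ T) → j₁ = j₂) ∧
      (∀ e ∈ T, 1 ≤ e.2.2 / 2 → ∃ (j : Fin k) (y : Fin m) (s : ℕ),
        (j :: e.1, (y, s)) ∈ T ∧ s / 2 + 1 = e.2.2 / 2))) ∧
        (∃ y : Fin m, (([] : List (Fin k)), (y, 2 * s)) ∈ T) ∧
        ∃ (j : Fin k) (y : Fin m) (s' : ℕ), ([j], (y, s')) ∈ T ∧ s' / 2 + 1 = 2 * s / 2) with hCeven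
    set Codd : Finset (Finset (List (Fin k) × (Fin m × ℕ))) := (TS (d + 1)).filter (fun T => (((∀ e ∈ T, ∀ (j : Fin k) (y : Fin m) (s : ℕ), (j :: e.1, (y, s)) ∈ T →
        s / 2 < e.2.2 / 2 ∧ ∃ j' : Fin k, ∀ lab : Fin m × ℕ, (j' :: j :: e.1, lab) ∉ T) ∧
      (∀ e ∈ T, ∀ (j : Fin k) (y : Fin m) (s : ℕ), (j :: e.1, (y, s)) ∈ T → s % 2 = 1 →
        ∀ j₁ j₂ : Fin k, (∀ lab : Fin m × ℕ, (j₁ :: j :: e.1, lab) ∉ T) →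
          (∀ lab : Fin m × ℕ, (j₂ :: j :: e.1, lab) ∉ T) → j₁ = j₂) ∧
      (∀ e ∈ T, 1 ≤ e.2.2 / 2 → ∃ (j : Fin k) (y : Fin m) (s : ℕ),
        (j :: e.1, (y, s)) ∈ T ∧ s / 2 + 1 = e.2.2 / 2))) ∧
        (∃ y : Fin m, (([] : List (Fin k)), (y, 2 * s + 1)) ∈ T) ∧
        (∃ (j : Fin k) (y : Fin m) (s' : ℕ), ([j], (y, s')) ∈ T ∧ s' / 2 + 1 = (2 * s + 1) / 2) ∧
        ∃ j₀ : Fin k, (∀ lab : Fin m × ℕ, ([j₀], lab) ∉ T) ∧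
          ∀ j : Fin k, j ≠ j₀ → ∃ lab : Fin m × ℕ, ([j], lab) ∈ T) with hCodd
    have hcov := sissR_sum_cover_le ((TS (d + 1)).filter (fun S => (((∀ e ∈ S, ∀ (j : Fin k) (y : Fin m) (s : ℕ), (j :: e.1, (y, s)) ∈ S →
        s / 2 < e.2.2 / 2 ∧ ∃ j' : Fin k, ∀ lab : Fin m × ℕ, (j' :: j :: e.1, lab) ∉ S) ∧
      (∀ e ∈ S, ∀ (j : Fin k) (y : Fin m) (s : ℕ), (j :: e.1, (y, s)) ∈ S → s % 2 = 1 →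
        ∀ j₁ j₂ : Fin k, (∀ lab : Fin m × ℕ, (j₁ :: j :: e.1, lab) ∉ S) →
          (∀ lab : Fin m × ℕ, (j₂ :: j :: e.1, lab) ∉ S) → j₁ = j₂) ∧
      (∀ e ∈ S, 1 ≤ e.2.2 / 2 → ∃ (j : Fin k) (y : Fin m) (s : ℕ),
        (j :: e.1, (y, s)) ∈ S ∧ s / 2 + 1 = e.2.2 / 2))) ∧ (∃ j : Fin k, ∀ lab : Fin m × ℕ, ([j], lab) ∉ S) ∧
        ((∀ (y : Fin m) (s : ℕ), (([] : List (Fin k)), (y, s)) ∈ S → s % 2 = 1 →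
        ∀ j₁ j₂ : Fin k, (∀ lab : Fin m × ℕ, ([j₁], lab) ∉ S) →
          (∀ lab : Fin m × ℕ, ([j₂], lab) ∉ S) → j₁ = j₂)) ∧ ∃ (y : Fin m) (r : ℕ), (([] : List (Fin k)), (y, r)) ∈ S ∧ r / 2 = s))
      (univ : Finset Bool) (fun b => if b = true then Ceven else Codd)
      (fun T => ∏ e ∈ T, ((1 / 2 : ℝ) ^ k * (if e.1 = [] then (1 : ℝ) else 1 / (n : ℝ)))) sissR_wt_nonneg (by
        intro T hT
        rw [Finset.mem_filter] at hT
        obtain ⟨hTS, hloc, hno, huniq, y, r, hy, hrs⟩ := hT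
        -- recency at the root
        obtain ⟨j, y', s', hy', hs'⟩ := hloc.2.2 _ hy (by simp only; omega)
        rcases Nat.even_or_odd r with ⟨t, ht⟩ | ⟨t, ht⟩
        · have hr : r = 2 * s := by omega
          subst hr
          refine ⟨true, mem_univ _, ?_⟩
          rw [if_pos rfl, hCeven, Finset.mem_filter]
          exact ⟨hTS, hloc, ⟨y, hy⟩, j, y', s', hy', hs'⟩
        · have hr : r = 2 * s + 1 := by omega
          subst hr
          refine ⟨false, mem_univ _, ?_⟩
          rw [if_neg Bool.false_ne_true, hCodd, Finset.mem_filter]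
          obtain ⟨j₀, hj₀⟩ := hno
          refine ⟨hTS, hloc, ⟨y, hy⟩, ⟨j, y', s', hy', hs'⟩, j₀, hj₀, fun j' hj' => ?_⟩
          by_contra hcon
          push Not at hcon
          exact hj' (huniq y (2 * s + 1) hy (by omega) j' j₀ (fun lab h => hcon lab h) hj₀))
    refine hcov.trans ?_
    rw [Fintype.sum_bool, if_pos rfl, if_neg Bool.false_ne_true]
    -- the sums of the previous depth
    set Asum : ℝ := ∑ S ∈ (TS d).filter (fun S => (((∀ e ∈ S, ∀ (j : Fin k) (y : Fin m) (s : ℕ), (j :: e.1, (y, s)) ∈ S →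
        s / 2 < e.2.2 / 2 ∧ ∃ j' : Fin k, ∀ lab : Fin m × ℕ, (j' :: j :: e.1, lab) ∉ S) ∧
      (∀ e ∈ S, ∀ (j : Fin k) (y : Fin m) (s : ℕ), (j :: e.1, (y, s)) ∈ S → s % 2 = 1 →
        ∀ j₁ j₂ : Fin k, (∀ lab : Fin m × ℕ, (j₁ :: j :: e.1, lab) ∉ S) →
          (∀ lab : Fin m × ℕ, (j₂ :: j :: e.1, lab) ∉ S) → j₁ = j₂) ∧
      (∀ e ∈ S, 1 ≤ e.2.2 / 2 → ∃ (j : Fin k) (y : Fin m) (s : ℕ),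
        (j :: e.1, (y, s)) ∈ S ∧ s / 2 + 1 = e.2.2 / 2))) ∧ (∃ j : Fin k, ∀ lab : Fin m × ℕ, ([j], lab) ∉ S) ∧ ((∀ (y : Fin m) (s : ℕ), (([] : List (Fin k)), (y, s)) ∈ S → s % 2 = 1 →
        ∀ j₁ j₂ : Fin k, (∀ lab : Fin m × ℕ, ([j₁], lab) ∉ S) →
          (∀ lab : Fin m × ℕ, ([j₂], lab) ∉ S) → j₁ = j₂)) ∧
        ∃ (y : Fin m) (r : ℕ), (([] : List (Fin k)), (y, r)) ∈ S ∧ r / 2 = s - 1), (∏ e ∈ S, ((1 / 2 : ℝ) ^ k * (if e.1 = [] then (1 : ℝ) else 1 / (n : ℝ)))) with hAsum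
    set Usum : ℝ := ∑ s' ∈ Finset.range s, ∑ S ∈ (TS d).filter (fun S => (((∀ e ∈ S, ∀ (j : Fin k) (y : Fin m) (s : ℕ), (j :: e.1, (y, s)) ∈ S →
        s / 2 < e.2.2 / 2 ∧ ∃ j' : Fin k, ∀ lab : Fin m × ℕ, (j' :: j :: e.1, lab) ∉ S) ∧
      (∀ e ∈ S, ∀ (j : Fin k) (y : Fin m) (s : ℕ), (j :: e.1, (y, s)) ∈ S → s % 2 = 1 →
        ∀ j₁ j₂ : Fin k, (∀ lab : Fin m × ℕ, (j₁ :: j :: e.1, lab) ∉ S) →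
          (∀ lab : Fin m × ℕ, (j₂ :: j :: e.1, lab) ∉ S) → j₁ = j₂) ∧
      (∀ e ∈ S, 1 ≤ e.2.2 / 2 → ∃ (j : Fin k) (y : Fin m) (s : ℕ),
        (j :: e.1, (y, s)) ∈ S ∧ s / 2 + 1 = e.2.2 / 2))) ∧ (∃ j : Fin k, ∀ lab : Fin m × ℕ, ([j], lab) ∉ S) ∧
        ((∀ (y : Fin m) (s : ℕ), (([] : List (Fin k)), (y, s)) ∈ S → s % 2 = 1 →
        ∀ j₁ j₂ : Fin k, (∀ lab : Fin m × ℕ, ([j₁], lab) ∉ S) →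
          (∀ lab : Fin m × ℕ, ([j₂], lab) ∉ S) → j₁ = j₂)) ∧ ∃ (y : Fin m) (r : ℕ), (([] : List (Fin k)), (y, r)) ∈ S ∧ r / 2 = s'), (∏ e ∈ S, ((1 / 2 : ℝ) ^ k * (if e.1 = [] then (1 : ℝ) else 1 / (n : ℝ))))
      with hUsum
    have hA : Asum ≤ (m : ℝ) * (1 / 2 : ℝ) ^ k * (2 / 3 : ℝ) ^ (s - 1) := ih (s - 1)
    have hA0 : 0 ≤ Asum := Finset.sum_nonneg fun S _ => sissR_wt_nonneg S
    have hU0 : 0 ≤ Usum := Finset.sum_nonneg fun s' _ => Finset.sum_nonneg fun S _ => sissR_wt_nonneg S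
    have hUle : Usum ≤ (m : ℝ) * (1 / 2 : ℝ) ^ k * 3 := by
      have hgeo : ∑ s' ∈ Finset.range s, (m : ℝ) * (1 / 2 : ℝ) ^ k * (2 / 3 : ℝ) ^ s'
          ≤ (m : ℝ) * (1 / 2 : ℝ) ^ k * 3 := by
        rw [← Finset.mul_sum]
        refine mul_le_mul_of_nonneg_left ?_ (by positivity)
        have := geom_sum_Ico_le_of_lt_one (show (0 : ℝ) ≤ 2 / 3 by norm_num)
          (show (2 / 3 : ℝ) < 1 by norm_num) (m := 0) (n := s)
        rw [Finset.range_eq_Ico]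
        refine this.trans ?_
        norm_num
      exact (Finset.sum_le_sum fun s' _ => ih s').trans hgeo
    -- the recent and lower sums of the two classes are dominated by `Asum` and `Usum`
    have hRec_le : ∀ r : ℕ, r / 2 = s →
        ∑ S ∈ (TS d).filter (fun S => (((∀ e ∈ S, ∀ (j : Fin k) (y : Fin m) (s : ℕ), (j :: e.1, (y, s)) ∈ S →
        s / 2 < e.2.2 / 2 ∧ ∃ j' : Fin k, ∀ lab : Fin m × ℕ, (j' :: j :: e.1, lab) ∉ S) ∧
      (∀ e ∈ S, ∀ (j : Fin k) (y : Fin m) (s : ℕ), (j :: e.1, (y, s)) ∈ S → s % 2 = 1 →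
        ∀ j₁ j₂ : Fin k, (∀ lab : Fin m × ℕ, (j₁ :: j :: e.1, lab) ∉ S) →
          (∀ lab : Fin m × ℕ, (j₂ :: j :: e.1, lab) ∉ S) → j₁ = j₂) ∧
      (∀ e ∈ S, 1 ≤ e.2.2 / 2 → ∃ (j : Fin k) (y : Fin m) (s : ℕ),
        (j :: e.1, (y, s)) ∈ S ∧ s / 2 + 1 = e.2.2 / 2))) ∧ (∃ j : Fin k, ∀ lab : Fin m × ℕ, ([j], lab) ∉ S) ∧ ((∀ (y : Fin m) (s : ℕ), (([] : List (Fin k)), (y, s)) ∈ S → s % 2 = 1 →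
        ∀ j₁ j₂ : Fin k, (∀ lab : Fin m × ℕ, ([j₁], lab) ∉ S) →
          (∀ lab : Fin m × ℕ, ([j₂], lab) ∉ S) → j₁ = j₂)) ∧
          ∃ (y : Fin m) (s' : ℕ), (([] : List (Fin k)), (y, s')) ∈ S ∧ s' / 2 + 1 = r / 2), (∏ e ∈ S, ((1 / 2 : ℝ) ^ k * (if e.1 = [] then (1 : ℝ) else 1 / (n : ℝ)))) ≤ Asum := by
      intro r hr
      refine Finset.sum_le_sum_of_subset_of_nonneg ?_ fun S _ _ => sissR_wt_nonneg S
      intro S hS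
      rw [Finset.mem_filter] at hS ⊢
      obtain ⟨hTS, hl, hno, hu, y, s', hy, hs'⟩ := hS
      exact ⟨hTS, hl, hno, hu, y, s', hy, by omega⟩
    have hU_le : ∀ r : ℕ, r / 2 = s →
        ∑ S ∈ (TS d).filter (fun S => (((∀ e ∈ S, ∀ (j : Fin k) (y : Fin m) (s : ℕ), (j :: e.1, (y, s)) ∈ S →
        s / 2 < e.2.2 / 2 ∧ ∃ j' : Fin k, ∀ lab : Fin m × ℕ, (j' :: j :: e.1, lab) ∉ S) ∧
      (∀ e ∈ S, ∀ (j : Fin k) (y : Fin m) (s : ℕ), (j :: e.1, (y, s)) ∈ S → s % 2 = 1 →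
        ∀ j₁ j₂ : Fin k, (∀ lab : Fin m × ℕ, (j₁ :: j :: e.1, lab) ∉ S) →
          (∀ lab : Fin m × ℕ, (j₂ :: j :: e.1, lab) ∉ S) → j₁ = j₂) ∧
      (∀ e ∈ S, 1 ≤ e.2.2 / 2 → ∃ (j : Fin k) (y : Fin m) (s : ℕ),
        (j :: e.1, (y, s)) ∈ S ∧ s / 2 + 1 = e.2.2 / 2))) ∧ (∃ j : Fin k, ∀ lab : Fin m × ℕ, ([j], lab) ∉ S) ∧ ((∀ (y : Fin m) (s : ℕ), (([] : List (Fin k)), (y, s)) ∈ S → s % 2 = 1 →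
        ∀ j₁ j₂ : Fin k, (∀ lab : Fin m × ℕ, ([j₁], lab) ∉ S) →
          (∀ lab : Fin m × ℕ, ([j₂], lab) ∉ S) → j₁ = j₂)) ∧
          ∃ (y : Fin m) (s' : ℕ), (([] : List (Fin k)), (y, s')) ∈ S ∧ s' / 2 < r / 2), (∏ e ∈ S, ((1 / 2 : ℝ) ^ k * (if e.1 = [] then (1 : ℝ) else 1 / (n : ℝ)))) ≤ Usum := by
      intro r hr
      refine sissR_sum_cover_le ((TS d).filter (fun S => (((∀ e ∈ S, ∀ (j : Fin k) (y : Fin m) (s : ℕ), (j :: e.1, (y, s)) ∈ S →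
        s / 2 < e.2.2 / 2 ∧ ∃ j' : Fin k, ∀ lab : Fin m × ℕ, (j' :: j :: e.1, lab) ∉ S) ∧
      (∀ e ∈ S, ∀ (j : Fin k) (y : Fin m) (s : ℕ), (j :: e.1, (y, s)) ∈ S → s % 2 = 1 →
        ∀ j₁ j₂ : Fin k, (∀ lab : Fin m × ℕ, (j₁ :: j :: e.1, lab) ∉ S) →
          (∀ lab : Fin m × ℕ, (j₂ :: j :: e.1, lab) ∉ S) → j₁ = j₂) ∧
      (∀ e ∈ S, 1 ≤ e.2.2 / 2 → ∃ (j : Fin k) (y : Fin m) (s : ℕ),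
        (j :: e.1, (y, s)) ∈ S ∧ s / 2 + 1 = e.2.2 / 2))) ∧ (∃ j : Fin k, ∀ lab : Fin m × ℕ, ([j], lab) ∉ S) ∧ ((∀ (y : Fin m) (s : ℕ), (([] : List (Fin k)), (y, s)) ∈ S → s % 2 = 1 →
        ∀ j₁ j₂ : Fin k, (∀ lab : Fin m × ℕ, ([j₁], lab) ∉ S) →
          (∀ lab : Fin m × ℕ, ([j₂], lab) ∉ S) → j₁ = j₂)) ∧
          ∃ (y : Fin m) (s' : ℕ), (([] : List (Fin k)), (y, s')) ∈ S ∧ s' / 2 < r / 2)) (Finset.range s)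
        (fun s' => (TS d).filter (fun S => (((∀ e ∈ S, ∀ (j : Fin k) (y : Fin m) (s : ℕ), (j :: e.1, (y, s)) ∈ S →
        s / 2 < e.2.2 / 2 ∧ ∃ j' : Fin k, ∀ lab : Fin m × ℕ, (j' :: j :: e.1, lab) ∉ S) ∧
      (∀ e ∈ S, ∀ (j : Fin k) (y : Fin m) (s : ℕ), (j :: e.1, (y, s)) ∈ S → s % 2 = 1 →
        ∀ j₁ j₂ : Fin k, (∀ lab : Fin m × ℕ, (j₁ :: j :: e.1, lab) ∉ S) →
          (∀ lab : Fin m × ℕ, (j₂ :: j :: e.1, lab) ∉ S) → j₁ = j₂) ∧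
      (∀ e ∈ S, 1 ≤ e.2.2 / 2 → ∃ (j : Fin k) (y : Fin m) (s : ℕ),
        (j :: e.1, (y, s)) ∈ S ∧ s / 2 + 1 = e.2.2 / 2))) ∧ (∃ j : Fin k, ∀ lab : Fin m × ℕ, ([j], lab) ∉ S) ∧ ((∀ (y : Fin m) (s : ℕ), (([] : List (Fin k)), (y, s)) ∈ S → s % 2 = 1 →
        ∀ j₁ j₂ : Fin k, (∀ lab : Fin m × ℕ, ([j₁], lab) ∉ S) →
          (∀ lab : Fin m × ℕ, ([j₂], lab) ∉ S) → j₁ = j₂)) ∧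
          ∃ (y : Fin m) (r : ℕ), (([] : List (Fin k)), (y, r)) ∈ S ∧ r / 2 = s'))
        (fun S => ∏ e ∈ S, ((1 / 2 : ℝ) ^ k * (if e.1 = [] then (1 : ℝ) else 1 / (n : ℝ)))) sissR_wt_nonneg ?_
      intro S hS
      rw [Finset.mem_filter] at hS
      obtain ⟨hTS, hl, hno, hu, y, s', hy, hs'⟩ := hS
      refine ⟨s' / 2, Finset.mem_range.2 (by omega), ?_⟩
      rw [Finset.mem_filter]
      exact ⟨hTS, hl, hno, hu, y, s', hy, rfl⟩
    -- the scalar data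
    have ha : Asum / n ≤ (m : ℝ) * (1 / 2 : ℝ) ^ k / n * (2 / 3 : ℝ) ^ (s - 1) := by
      rw [div_mul_eq_mul_div]
      exact div_le_div_of_nonneg_right hA hn0.le
    have hu : Usum / n ≤ 3 / (4 * (k : ℝ)) := by
      calc Usum / n ≤ (m : ℝ) * (1 / 2 : ℝ) ^ k * 3 / n := div_le_div_of_nonneg_right hUle hn0.le
        _ = 3 * ((m : ℝ) * (1 / 2 : ℝ) ^ k / n) := by ring
        _ ≤ 3 * (1 / (4 * k)) := by linarith [hdens]
        _ = 3 / (4 * k) := by ring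
    have hcore := sissW_num_core k s hk hs (m : ℝ) ((m : ℝ) * (1 / 2 : ℝ) ^ k / n) (Asum / n) (Usum / n)
      hm0 (by positivity) hkD ha (div_nonneg hU0 hn0.le) hu
    -- the two class bounds
    have hEven : ∑ T ∈ Ceven, (∏ e ∈ T, ((1 / 2 : ℝ) ^ k * (if e.1 = [] then (1 : ℝ) else 1 / (n : ℝ)))) ≤ (m : ℝ) * k * (1 / 2 : ℝ) ^ k * (Asum / n) * (1 + Usum / n) ^ (k - 1) := by
      refine (sissW_weight_recent asm hasm TS L hTS0 hTSs d (2 * s)).trans ?_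
      have h1 := hRec_le (2 * s) (by omega)
      have h2 := hU_le (2 * s) (by omega)
      have hRn : 0 ≤ (∑ S ∈ (TS d).filter (fun S => (((∀ e ∈ S, ∀ (j : Fin k) (y : Fin m) (s : ℕ), (j :: e.1, (y, s)) ∈ S →
        s / 2 < e.2.2 / 2 ∧ ∃ j' : Fin k, ∀ lab : Fin m × ℕ, (j' :: j :: e.1, lab) ∉ S) ∧
      (∀ e ∈ S, ∀ (j : Fin k) (y : Fin m) (s : ℕ), (j :: e.1, (y, s)) ∈ S → s % 2 = 1 →
        ∀ j₁ j₂ : Fin k, (∀ lab : Fin m × ℕ, (j₁ :: j :: e.1, lab) ∉ S) →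
          (∀ lab : Fin m × ℕ, (j₂ :: j :: e.1, lab) ∉ S) → j₁ = j₂) ∧
      (∀ e ∈ S, 1 ≤ e.2.2 / 2 → ∃ (j : Fin k) (y : Fin m) (s : ℕ),
        (j :: e.1, (y, s)) ∈ S ∧ s / 2 + 1 = e.2.2 / 2))) ∧ (∃ j : Fin k, ∀ lab : Fin m × ℕ, ([j], lab) ∉ S) ∧ ((∀ (y : Fin m) (s : ℕ), (([] : List (Fin k)), (y, s)) ∈ S → s % 2 = 1 →
        ∀ j₁ j₂ : Fin k, (∀ lab : Fin m × ℕ, ([j₁], lab) ∉ S) →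
          (∀ lab : Fin m × ℕ, ([j₂], lab) ∉ S) → j₁ = j₂)) ∧
          ∃ (y : Fin m) (s' : ℕ), (([] : List (Fin k)), (y, s')) ∈ S ∧ s' / 2 + 1 = 2 * s / 2), (∏ e ∈ S, ((1 / 2 : ℝ) ^ k * (if e.1 = [] then (1 : ℝ) else 1 / (n : ℝ))))) :=
        Finset.sum_nonneg fun S _ => sissR_wt_nonneg S
      have hUn : 0 ≤ (∑ S ∈ (TS d).filter (fun S => (((∀ e ∈ S, ∀ (j : Fin k) (y : Fin m) (s : ℕ), (j :: e.1, (y, s)) ∈ S →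
        s / 2 < e.2.2 / 2 ∧ ∃ j' : Fin k, ∀ lab : Fin m × ℕ, (j' :: j :: e.1, lab) ∉ S) ∧
      (∀ e ∈ S, ∀ (j : Fin k) (y : Fin m) (s : ℕ), (j :: e.1, (y, s)) ∈ S → s % 2 = 1 →
        ∀ j₁ j₂ : Fin k, (∀ lab : Fin m × ℕ, (j₁ :: j :: e.1, lab) ∉ S) →
          (∀ lab : Fin m × ℕ, (j₂ :: j :: e.1, lab) ∉ S) → j₁ = j₂) ∧
      (∀ e ∈ S, 1 ≤ e.2.2 / 2 → ∃ (j : Fin k) (y : Fin m) (s : ℕ),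
        (j :: e.1, (y, s)) ∈ S ∧ s / 2 + 1 = e.2.2 / 2))) ∧ (∃ j : Fin k, ∀ lab : Fin m × ℕ, ([j], lab) ∉ S) ∧ ((∀ (y : Fin m) (s : ℕ), (([] : List (Fin k)), (y, s)) ∈ S → s % 2 = 1 →
        ∀ j₁ j₂ : Fin k, (∀ lab : Fin m × ℕ, ([j₁], lab) ∉ S) →
          (∀ lab : Fin m × ℕ, ([j₂], lab) ∉ S) → j₁ = j₂)) ∧
          ∃ (y : Fin m) (s' : ℕ), (([] : List (Fin k)), (y, s')) ∈ S ∧ s' / 2 < 2 * s / 2), (∏ e ∈ S, ((1 / 2 : ℝ) ^ k * (if e.1 = [] then (1 : ℝ) else 1 / (n : ℝ))))) :=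
        Finset.sum_nonneg fun S _ => sissR_wt_nonneg S
      exact sissW_mono_recent k ((m : ℝ) * k * (1 / 2 : ℝ) ^ k) n _ _ _ _ (by positivity) hn0 hRn h1 hUn h2
    have hOdd : ∑ T ∈ Codd, (∏ e ∈ T, ((1 / 2 : ℝ) ^ k * (if e.1 = [] then (1 : ℝ) else 1 / (n : ℝ)))) ≤ (m : ℝ) * k * k * (1 / 2 : ℝ) ^ k * (Asum / n) * (Usum / n) ^ (k - 2) := by
      refine (sissW_weight_odd asm hasm TS L hTS0 hTSs d (2 * s + 1)).trans ?_
      have h1 := hRec_le (2 * s + 1) (by omega)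
      have h2 := hU_le (2 * s + 1) (by omega)
      have hRn : 0 ≤ (∑ S ∈ (TS d).filter (fun S => (((∀ e ∈ S, ∀ (j : Fin k) (y : Fin m) (s : ℕ), (j :: e.1, (y, s)) ∈ S →
        s / 2 < e.2.2 / 2 ∧ ∃ j' : Fin k, ∀ lab : Fin m × ℕ, (j' :: j :: e.1, lab) ∉ S) ∧
      (∀ e ∈ S, ∀ (j : Fin k) (y : Fin m) (s : ℕ), (j :: e.1, (y, s)) ∈ S → s % 2 = 1 →
        ∀ j₁ j₂ : Fin k, (∀ lab : Fin m × ℕ, (j₁ :: j :: e.1, lab) ∉ S) →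
          (∀ lab : Fin m × ℕ, (j₂ :: j :: e.1, lab) ∉ S) → j₁ = j₂) ∧
      (∀ e ∈ S, 1 ≤ e.2.2 / 2 → ∃ (j : Fin k) (y : Fin m) (s : ℕ),
        (j :: e.1, (y, s)) ∈ S ∧ s / 2 + 1 = e.2.2 / 2))) ∧ (∃ j : Fin k, ∀ lab : Fin m × ℕ, ([j], lab) ∉ S) ∧ ((∀ (y : Fin m) (s : ℕ), (([] : List (Fin k)), (y, s)) ∈ S → s % 2 = 1 →
        ∀ j₁ j₂ : Fin k, (∀ lab : Fin m × ℕ, ([j₁], lab) ∉ S) →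
          (∀ lab : Fin m × ℕ, ([j₂], lab) ∉ S) → j₁ = j₂)) ∧
          ∃ (y : Fin m) (s' : ℕ), (([] : List (Fin k)), (y, s')) ∈ S ∧ s' / 2 + 1 = (2 * s + 1) / 2), (∏ e ∈ S, ((1 / 2 : ℝ) ^ k * (if e.1 = [] then (1 : ℝ) else 1 / (n : ℝ))))) :=
        Finset.sum_nonneg fun S _ => sissR_wt_nonneg S
      have hUn : 0 ≤ (∑ S ∈ (TS d).filter (fun S => (((∀ e ∈ S, ∀ (j : Fin k) (y : Fin m) (s : ℕ), (j :: e.1, (y, s)) ∈ S →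
        s / 2 < e.2.2 / 2 ∧ ∃ j' : Fin k, ∀ lab : Fin m × ℕ, (j' :: j :: e.1, lab) ∉ S) ∧
      (∀ e ∈ S, ∀ (j : Fin k) (y : Fin m) (s : ℕ), (j :: e.1, (y, s)) ∈ S → s % 2 = 1 →
        ∀ j₁ j₂ : Fin k, (∀ lab : Fin m × ℕ, (j₁ :: j :: e.1, lab) ∉ S) →
          (∀ lab : Fin m × ℕ, (j₂ :: j :: e.1, lab) ∉ S) → j₁ = j₂) ∧
      (∀ e ∈ S, 1 ≤ e.2.2 / 2 → ∃ (j : Fin k) (y : Fin m) (s : ℕ),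
        (j :: e.1, (y, s)) ∈ S ∧ s / 2 + 1 = e.2.2 / 2))) ∧ (∃ j : Fin k, ∀ lab : Fin m × ℕ, ([j], lab) ∉ S) ∧ ((∀ (y : Fin m) (s : ℕ), (([] : List (Fin k)), (y, s)) ∈ S → s % 2 = 1 →
        ∀ j₁ j₂ : Fin k, (∀ lab : Fin m × ℕ, ([j₁], lab) ∉ S) →
          (∀ lab : Fin m × ℕ, ([j₂], lab) ∉ S) → j₁ = j₂)) ∧
          ∃ (y : Fin m) (s' : ℕ), (([] : List (Fin k)), (y, s')) ∈ S ∧ s' / 2 < (2 * s + 1) / 2), (∏ e ∈ S, ((1 / 2 : ℝ) ^ k * (if e.1 = [] then (1 : ℝ) else 1 / (n : ℝ))))) :=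
        Finset.sum_nonneg fun S _ => sissR_wt_nonneg S
      exact sissW_mono_odd k ((m : ℝ) * k * k * (1 / 2 : ℝ) ^ k) n _ _ _ _ (by positivity) hn0 hRn h1 hUn h2
    exact (add_le_add hEven hOdd).trans hcore

end WeightBound

end Summit.PneNP.PneNP.Theorems
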